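import Summits.BirchSwinnertonDyer.BirchSwinnertonDyer.Theorems.SylvesterTwoHeegnerIndexUpperConeOfPrintExactByName
import HarnessLib

/-!
# Route `SylvesterTwoHeegnerIndex` (rung K7t): the ASIDE UPPER twins `UpperOffV0HSY`
# (stmt-BirchSwinnertonDyer-19581) and `HeegnerIndexUpperAtTwoHSYOfFacts` (stmt-…-19476), and the
# fact-free pair statement `TwoAdicPairHSY` (stmt-…-19580 = the registered stub `stub_twoAdicPairHSY`
# of 19476), BY NAME from the four named PRINT facts `{(G3′), #19, #20, VII}`

Seat `leafhand-bsd-sylvestertwoheegne-2` g0 (explicit unit; items 19476 / 19581 / 19230 of route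
`SylvesterTwoHeegnerIndex`).  THEOREMS ONLY: compositions of landed theorems; no definition, no named
fact, no instance, no notation, no `sorry`.

WHAT THIS FILE IS.  Items 19476 `HeegnerIndexUpperAtTwoHSYOfFacts` and 19581 `UpperOffV0HSY` are the
facts-conditional ASIDE twins (antecedent `PublishedFactsTwo`, item 19231) of the live UPPER cone
19725 `HeegnerIndexUpperAtTwoHSYOfFactsPlus` / 19804 `UpperOffV0HSYPlus` (antecedent
`PublishedFactsTwoPlus = PublishedFactsTwo ∧ #19`, #19 = Hu–Shu–Yin's height display
`HuShuYin2019.shaAnPair_mul_height_eq_two_zpow_mul_height`, item 19726).  Seat `bsd-cm-k7t-c2` g34/g35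
proved the live cone BY NAME from the four NAMED print facts
`{(G3′) HuShuYin2019.exists_deg_eq_six_isS3Invariant, #19 HuShuYin2019.shaAnPair_mul_height_eq_two_zpow_mul_height_named,
#20 Nekovar2007.cmPoint_frobeniusCongruence, VII casselsTate_canonical_adjoint}`
(`SylvesterTwoUpperConePrintExact.upperOffV0HSYPlus_of_named`,
`….heegnerIndexUpperAtTwoHSYOfFactsPlus_of_named`, p755365 ff.).  This file RECORDS THE SAME READING FOR
THE ASIDE TWINS, which differ from the live cone exactly by the conjunct #19 of the antecedent, and #19
(unnamed) is a corollary of #19 (named) (`shaAnPair_mul_height_eq_two_zpow_mul_height_of_named`):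

* §1 (fact-level glue, unconditional implications) `upperOffV0HSY_of_display_of_plus`,
  `heegnerIndexUpperAtTwoHSYOfFacts_of_display_of_plus`: #19 → Plus twin → aside twin;
* §2 ★ `upperOffV0HSY_of_named` — THE ROUTE DECL of item 19581 BY NAME from `{(G3′), #19, #20, VII}`;
  ★ `heegnerIndexUpperAtTwoHSYOfFacts_of_named` — THE ROUTE DECL of item 19476 BY NAME from the same;
  ★ `twoAdicPairHSY_of_publishedFactsTwoPlus_of_named` — THE ROUTE DECL `TwoAdicPairHSY` of item 19580,
  which is VERBATIM the registered stub `stub_twoAdicPairHSY` of 19476's skeleton (bcfe488db9558f4d),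
  from `PublishedFactsTwoPlus` + `{(G3′), #19}` (THEOREM C from the prints, then x1b's assembly
  `SylvesterTwoThmCAssembly.twoAdicPairHSY_of_heightDisplay_of_thmC`);
* §3 `indexBoundOffV0HSY_of_named` — the TEXT of the second registered stub `stub_indexBoundOffV0HSY` of
  19476's skeleton (= `UpperOffV0HSY` with the antecedent folded to `PublishedFactsTwo`) from
  `{(G3′), #19, #20, VII}`; `heegnerIndexUpperAtTwoHSYOfFacts_of_named'` — 19476 again, run through its own
  registered skeleton composition (the landed glue 19582
  `SylvesterTwoUpper.upperOfFacts_of_twoAdicPair_of_offV0`, p431798) on §2/§3, as a check that the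
  skeleton of record closes from the prints.

READING OF RECORD (kernel-checked here): the aside UPPER twins 19476 / 19581 and the pair stub 19580
⟸ PRINT `{(G3′), #19 named, #20 (ES2), VII}` (+ the route's own `PublishedFactsTwoPlus` for 19580) —
ZERO research hypotheses; the SAME trust base as the live cone 19725 / 19804.

HONEST LABEL: CONDITIONAL theorems — every print input is DISPLAYED as a hypothesis (cite-tagged
Literature `Prop`s), not proved; no ledger item is closed by this file (the gate records
`proof.conditional`); the registered stubs of 19476 are NOT closed by name (their fact-free texts are
meaningful only behind the facts, planner D82 (a)); `X12.CMAtTwo` is NOT proved; BSD is proved for no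
curve, by none of this.

## References
* Y. Hu, J. Shu, H. Yin, *An explicit Gross–Zagier formula related to the Sylvester conjecture*,
  Trans. AMS 372 (2019) = arXiv:1708.05266: Thm. 1.4, Prop. 2.1 (1), Cor. 4.4, display (bsd) p. 12,
  §4.1. [HuShuYin2019]
* J. Nekovář, *The Euler system method for CM points on Shimura curves* (2007), Prop. 4.9. [Nekovar2007]
* J. S. Milne, *Arithmetic Duality Theorems*, 2nd ed. (2006), Ch. I §6. [MilneADT2006]
* T. Fisher, *The Cassels–Tate pairing and the Platonic solids*, JNT 98 (2003), Prop. 2.16. [Fisher2003]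
* W. G. McCallum, *Kolyvagin's work on Shafarevich–Tate groups*, LMS LNS 153 (1991), §4–§5. [McCallumLMS1991]
* V. A. Kolyvagin, *Euler systems* (1990), Thm. A. [Kolyvagin1990]
-/

set_option linter.dupNamespace false -- Summits modules are `Summit.<Summit>.<Problem>…` by design
set_option autoImplicit false

noncomputable section

open scoped Classical

open WeierstrassCurve
open Literature.NumberTheory.EllipticCurves Literature.NumberTheory.EllipticCurves.ModularForms
  Literature.NumberTheory.EllipticCurves.HuShuYin2019
  Literature.NumberTheory.EllipticCurves.Rank1Residual.Typed
open Summit.BirchSwinnertonDyer.BirchSwinnertonDyer.Theses.SylvesterTwoHeegnerIndex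
  hiding HSYPointTwoDivisibleSevenModNine
open Summit.BirchSwinnertonDyer.BirchSwinnertonDyer.Theorems
  Summit.BirchSwinnertonDyer.BirchSwinnertonDyer.Theorems.SylvesterTwoUpperConePrintExact

namespace Summit.BirchSwinnertonDyer.BirchSwinnertonDyer.Theorems.SylvesterTwoUpperAsideTwins

/-! ## §1 Fact-level glue: #19 → Plus twin → aside twin -/

/-- **19581 ⟸ #19 + 19804.**  The aside twin `UpperOffV0HSY` (antecedent `PublishedFactsTwo`) follows from
its facts-plus twin `UpperOffV0HSYPlus` (antecedent `PublishedFactsTwo ∧ #19`) and Hu–Shu–Yin's height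
display #19.  Unconditional implication; composition only. [cite: HuShuYin2019, display (bsd) p. 12] -/
theorem upperOffV0HSY_of_display_of_plus (hD : shaAnPair_mul_height_eq_two_zpow_mul_height)
    (hP : UpperOffV0HSYPlus) : UpperOffV0HSY :=
  fun hF ↦ hP ⟨hF, hD⟩

/-- **19476 ⟸ #19 + 19725.**  The aside twin `HeegnerIndexUpperAtTwoHSYOfFacts` follows from its
facts-plus twin `HeegnerIndexUpperAtTwoHSYOfFactsPlus` and the height display #19.  Unconditional
implication; composition only. [cite: HuShuYin2019, display (bsd) p. 12] -/
theorem heegnerIndexUpperAtTwoHSYOfFacts_of_display_of_plus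
    (hD : shaAnPair_mul_height_eq_two_zpow_mul_height) (hP : HeegnerIndexUpperAtTwoHSYOfFactsPlus) :
    HeegnerIndexUpperAtTwoHSYOfFacts :=
  fun hF ↦ hP ⟨hF, hD⟩

/-- **`PublishedFactsTwoPlus` ⟸ `PublishedFactsTwo` + #19 (named).**  Bookkeeping for the antecedents.
[cite: HuShuYin2019, display (bsd) p. 12] -/
theorem publishedFactsTwoPlus_of_facts_of_named (hF : PublishedFactsTwo)
    (hD : shaAnPair_mul_height_eq_two_zpow_mul_height_named) : PublishedFactsTwoPlus :=
  ⟨hF, shaAnPair_mul_height_eq_two_zpow_mul_height_of_named hD⟩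

/-! ## §2 The aside twins BY NAME from the named print facts `{(G3′), #19, #20, VII}` -/

/-- ★ **THE ROUTE DECL of item 19581 `UpperOffV0HSY` BY NAME from `{(G3′), #19, #20, VII}`** — the off-𝒱₀
sharp `2`-adic Kolyvagin bound for the Hu–Shu–Yin pair, granted the route's published facts
`PublishedFactsTwo` (its own antecedent) and the displayed named PRINT facts: g35's
`upperOffV0HSYPlus_of_named` and §1.  READING OF RECORD: item 19581 ⟸ PRINT `{(G3′), #19, #20, VII}`,
zero research hypotheses — the same trust base as its live twin 19804.  CONDITIONAL; item 19581 is not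
closed by this; BSD is proved for no curve.
[cite: HuShuYin2019, Thm. 1.4, Prop. 2.1 (1), Cor. 4.4, display (bsd) p. 12, §4.1]
[cite: Nekovar2007, Prop. 4.9] [cite: Fisher2003, Prop. 2.16 (JNT 98, p. 132)]
[cite: MilneADT2006, Ch. I §6 Prop. 6.9, Thm. 6.13(a)] [cite: McCallumLMS1991, §4–§5, Thm. 5.4] -/
theorem upperOffV0HSY_of_named (hG3' : exists_deg_eq_six_isS3Invariant)
    (hD : shaAnPair_mul_height_eq_two_zpow_mul_height_named) (hES2 : Nekovar2007.cmPoint_frobeniusCongruence)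
    (hVII : ∀ (K : Type) [Field K] [NumberField K] (σ₀ : K ≃ₐ[ℚ] K) (h2 : Module.finrank ℚ K = 2)
      (hσ₀ : σ₀ ≠ 1), casselsTate_canonical_adjoint K σ₀ h2 hσ₀) :
    Summit.BirchSwinnertonDyer.BirchSwinnertonDyer.Theses.SylvesterTwoHeegnerIndex.UpperOffV0HSY :=
  upperOffV0HSY_of_display_of_plus (shaAnPair_mul_height_eq_two_zpow_mul_height_of_named hD)
    (upperOffV0HSYPlus_of_named hG3' hD hES2 hVII)

/-- ★ **THE ROUTE DECL of item 19476 `HeegnerIndexUpperAtTwoHSYOfFacts` BY NAME from `{(G3′), #19, #20,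
VII}`** — the Kolyvagin direction `ord₂ #Ш(E_p) ≤ ord₂ 𝔮` in every Heegner frame on 𝒞_HSY, granted
`PublishedFactsTwo` (its own antecedent) and the displayed named PRINT facts: g35's
`heegnerIndexUpperAtTwoHSYOfFactsPlus_of_named` and §1.  READING OF RECORD: item 19476 ⟸ PRINT
`{(G3′), #19, #20, VII}`, zero research hypotheses.  CONDITIONAL; item 19476 is not closed by this;
`X12.CMAtTwo` NOT proved; BSD is proved for no curve.
[cite: HuShuYin2019, Thm. 1.4, Prop. 2.1 (1), Cor. 4.4, display (bsd) p. 12, §4.1]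
[cite: Nekovar2007, Prop. 4.9] [cite: Fisher2003, Prop. 2.16 (JNT 98, p. 132)]
[cite: MilneADT2006, Ch. I §6 Prop. 6.9, Thm. 6.13(a)] [cite: Kolyvagin1990, Thm. A] -/
theorem heegnerIndexUpperAtTwoHSYOfFacts_of_named (hG3' : exists_deg_eq_six_isS3Invariant)
    (hD : shaAnPair_mul_height_eq_two_zpow_mul_height_named) (hES2 : Nekovar2007.cmPoint_frobeniusCongruence)
    (hVII : ∀ (K : Type) [Field K] [NumberField K] (σ₀ : K ≃ₐ[ℚ] K) (h2 : Module.finrank ℚ K = 2)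
      (hσ₀ : σ₀ ≠ 1), casselsTate_canonical_adjoint K σ₀ h2 hσ₀) :
    Summit.BirchSwinnertonDyer.BirchSwinnertonDyer.Theses.SylvesterTwoHeegnerIndex.HeegnerIndexUpperAtTwoHSYOfFacts :=
  heegnerIndexUpperAtTwoHSYOfFacts_of_display_of_plus (shaAnPair_mul_height_eq_two_zpow_mul_height_of_named hD)
    (heegnerIndexUpperAtTwoHSYOfFactsPlus_of_named hG3' hD hES2 hVII)

/-- **THEOREM C (the cell def `SylvesterTwoNonneg.HSYPointTwoDivisibleSevenModNine`) from `PublishedFactsTwoPlus`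
+ `{(G3′), #19}`**: g34's `SylvesterTwoUpperCone.thmC_of_isS3Invariant` at the `⟨w₂₄₃, A⟩`-invariant
degree-`6` datum supplied by (G3′).  CONDITIONAL; closes nothing; BSD is proved for no curve.
[cite: HuShuYin2019, Prop. 2.1 (1), §2.2, display (bsd) p. 12, §4.1] -/
theorem thmC_of_publishedFactsTwoPlus_of_named (hF : PublishedFactsTwoPlus)
    (hG3' : exists_deg_eq_six_isS3Invariant) (hD : shaAnPair_mul_height_eq_two_zpow_mul_height_named) :
    SylvesterTwoNonneg.HSYPointTwoDivisibleSevenModNine := by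
  obtain ⟨Dt, hdeg, hS3⟩ := hG3'
  exact SylvesterTwoUpperCone.thmC_of_isS3Invariant Dt hdeg hD hS3 hF

/-- ★ **THE ROUTE DECL `TwoAdicPairHSY` of item 19580 — VERBATIM the registered stub `stub_twoAdicPairHSY` of
19476's skeleton — from `PublishedFactsTwoPlus` + `{(G3′), #19}`**: for every prime `p ≡ 4, 7 (mod 9)`
with `3 ∉ 𝔽_p^{×3}` and all minimal `B ≅ E_p`, `A ≅ E_{3p²}`, `#Ш_an(B)`, `#Ш_an(A)` are rational with
non-zero product of EVEN `2`-adic valuation.  x1b's assembly `twoAdicPairHSY_of_heightDisplay_of_thmC`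
(p456911) on #19 (unnamed ⟸ named) and THEOREM C from the prints.  CONDITIONAL; neither 19580 nor the
stub is closed by this (the stub's fact-free text needs #19); BSD is proved for no curve.
[cite: HuShuYin2019, Thm. 1.3/1.4, Prop. 2.1 (1), Cor. 4.4, display (bsd) p. 12, §4.1] -/
theorem twoAdicPairHSY_of_publishedFactsTwoPlus_of_named (hF : PublishedFactsTwoPlus)
    (hG3' : exists_deg_eq_six_isS3Invariant) (hD : shaAnPair_mul_height_eq_two_zpow_mul_height_named) :
    Summit.BirchSwinnertonDyer.BirchSwinnertonDyer.Theses.SylvesterTwoHeegnerIndex.TwoAdicPairHSY :=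
  SylvesterTwoThmCAssembly.twoAdicPairHSY_of_heightDisplay_of_thmC
    (shaAnPair_mul_height_eq_two_zpow_mul_height_of_named hD)
    (thmC_of_publishedFactsTwoPlus_of_named hF hG3' hD)

/-! ## §3 The registered skeleton of 19476 (line «pair», bcfe488db9558f4d) run from the prints -/

/-- **The TEXT of the registered stub `stub_indexBoundOffV0HSY` of 19476's skeleton from `{(G3′), #19,
#20, VII}`** — it is `UpperOffV0HSY` with the antecedent folded to the name `PublishedFactsTwo`
(definitionally equal), i.e. ★ `upperOffV0HSY_of_named`.  CONDITIONAL; the stub is not closed by name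
(its text is fact-free in the prints); BSD is proved for no curve.
[cite: HuShuYin2019, Thm. 1.4, Prop. 2.1 (1), Cor. 4.4, §4.1] [cite: Nekovar2007, Prop. 4.9]
[cite: MilneADT2006, Ch. I §6 Prop. 6.9, Thm. 6.13(a)] -/
theorem indexBoundOffV0HSY_of_named (hG3' : exists_deg_eq_six_isS3Invariant)
    (hD : shaAnPair_mul_height_eq_two_zpow_mul_height_named) (hES2 : Nekovar2007.cmPoint_frobeniusCongruence)
    (hVII : ∀ (K : Type) [Field K] [NumberField K] (σ₀ : K ≃ₐ[ℚ] K) (h2 : Module.finrank ℚ K = 2)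
      (hσ₀ : σ₀ ≠ 1), casselsTate_canonical_adjoint K σ₀ h2 hσ₀) :
    PublishedFactsTwo → ∀ (p : ℕ), p.Prime → (p % 9 = 4 ∨ p % 9 = 7) → (¬ ∃ x : ZMod p, x ^ 3 = 3) →
      ∀ (A B : WeierstrassCurve ℚ) [A.IsElliptic] [A.IsGloballyMinimal] [B.IsElliptic] [B.IsGloballyMinimal],
      (∃ C : VariableChange ℚ, C • B = cubeSumCurve (p : ℚ)) →
      (∃ C : VariableChange ℚ, C • A = cubeSumCurve (3 * (p : ℚ) ^ 2)) →
      ¬ (Nat.card (AddCommGroup.primaryComponent B.sha 2) = 1 ∧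
          Nat.card (AddCommGroup.primaryComponent A.sha 2) = 1) →
      MissingUpperBoundAt B 2 :=
  fun hF ↦ upperOffV0HSY_of_named hG3' hD hES2 hVII hF

/-- **Item 19476 through ITS OWN registered skeleton composition**: the landed glue 19582
`SylvesterTwoUpper.upperOfFacts_of_twoAdicPair_of_offV0` (p431798; binder hBC = the pair statement,
hoff = the off-𝒱₀ bound) fed with ★ `twoAdicPairHSY_of_publishedFactsTwoPlus_of_named` (at the facts-plus
antecedent assembled from `PublishedFactsTwo` + #19 named) and `indexBoundOffV0HSY_of_named` — equal
to ★ `heegnerIndexUpperAtTwoHSYOfFacts_of_named` as a proposition; recorded as the check that the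
skeleton of record (line «pair») closes from the prints.  CONDITIONAL; closes nothing; BSD is proved for
no curve. [cite: HuShuYin2019, Thm. 1.4, Prop. 2.1 (1), Cor. 4.4, display (bsd) p. 12, §4.1]
[cite: Nekovar2007, Prop. 4.9] [cite: MilneADT2006, Ch. I §6 Prop. 6.9, Thm. 6.13(a)] -/
theorem heegnerIndexUpperAtTwoHSYOfFacts_of_named' (hG3' : exists_deg_eq_six_isS3Invariant)
    (hD : shaAnPair_mul_height_eq_two_zpow_mul_height_named) (hES2 : Nekovar2007.cmPoint_frobeniusCongruence)
    (hVII : ∀ (K : Type) [Field K] [NumberField K] (σ₀ : K ≃ₐ[ℚ] K) (h2 : Module.finrank ℚ K = 2)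
      (hσ₀ : σ₀ ≠ 1), casselsTate_canonical_adjoint K σ₀ h2 hσ₀) :
    Summit.BirchSwinnertonDyer.BirchSwinnertonDyer.Theses.SylvesterTwoHeegnerIndex.HeegnerIndexUpperAtTwoHSYOfFacts :=
  fun hF ↦
    SylvesterTwoUpper.upperOfFacts_of_twoAdicPair_of_offV0
      (twoAdicPairHSY_of_publishedFactsTwoPlus_of_named (publishedFactsTwoPlus_of_facts_of_named hF hD) hG3' hD)
      (indexBoundOffV0HSY_of_named hG3' hD hES2 hVII) hF

end Summit.BirchSwinnertonDyer.BirchSwinnertonDyer.Theorems.SylvesterTwoUpperAsideTwins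

end
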